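import Summits.MatrixMultiplication.MatrixMultiplication.Theses.EisensteinValCertificates
import Summits.MatrixMultiplication.MatrixMultiplication.Theorems.AutomaticSTPPDesignsAutomaticPackingThesisPrattVal

/-!
# Refutation of `EisensteinValCertificates.PrimeValConjecture` (stmt-MatrixMultiplication-7789)

Route `MatrixMultiplication/EisensteinValCertificates`, rank-3 crux `PrimeValConjecture` = Pratt 2024,
Conjecture 4.1 restricted to prime moduli ("for every `ε > 0` there is `K` such that for every prime
`p` and every equilateral-trapezoid-free `(A,B,C) ⊂ ℤ/p`, `#{a+b+c = 0} ≤ K p^{1+ε}`") — the spine of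
the route's kill ladder (`ValTransfer : PrimePowerPackingBarrier → PrimeValConjecture →
NoHomocyclicSTPP`).  It is FALSE: the landed tree theorem
`AutomaticPackingThesis.prattVal_prime_not_subpolynomial`
(`Theorems/AutomaticSTPPDesignsAutomaticPackingThesisPrattVal.lean`) gives `c, K > 0` with
`K P^{1+c} ≤ Val(ℤ/Pℤ)` for every prime `P` (CKSU 2005 §5 two-triple STPP design in
`ℤ/4 × ℤ/5 × ℤ/7 ≅ ℤ/140` of mass `144 > 140`; lossless digit-box powers inside the cyclic tower
`ℤ/140^k`; Pratt Prop. 3.3; reflection into `ℤ/N`, `N ≥ 3·140^k`), and `Val(ℤ/pℤ)` is attained by a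
trapezoid-free triple (`exists_prattVal_eq`), whose defining clauses are verbatim the inline clauses of
the route decl.
-/

section buildfix_record -- buildfix lane 2026-08-19: re-created record(s) of dropped route item(s), see docstring(s)
open scoped BigOperators Topology Manifold Classical MeasureTheory ProbabilityTheory Matrix InnerProductSpace ComplexConjugate ContinuousMap
open Filter Set Function TopologicalSpace MeasureTheory
namespace Summit.MatrixMultiplication.MatrixMultiplication.Theses.EisensteinValCertificates

/-- **Record of the dropped route item `PrimeValConjecture`** = stmt-MatrixMultiplication-7789 (ledger signature verbatim; NOT a route
item): route EisensteinValCertificates rev 5 (2026-08-17T13:07Z) dropped the refuted crux `PrimeValConjecture` (refuted-substantive by the theorem below; item closed `refuted`); the route file's own repair note asks for exactly this re-declaration. The declaration `Summit.MatrixMultiplication.MatrixMultiplication.Theses.EisensteinValCertificates.PrimeValConjecture`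
therefore no longer exists in the route file and this accepted module stopped elaborating (stale olean;
buildfix lane 2026-08-19). Re-created here under its original name so the result keeps building; the
statement of every previously accepted declaration in this file is unchanged. -/
def PrimeValConjecture : Prop :=
  ∀ ε : ℝ, 0 < ε → ∃ K : ℝ, ∀ p : ℕ, p.Prime → ∀ A B C : Finset (ZMod p), ((∀ a' ∈ A, ∀ b' ∈ B, ((A ×ˢ B ×ˢ C).filter (fun t : ZMod p × ZMod p × ZMod p => a' + t.2.1 + t.2.2 = 0 ∧ t.1 + b' + t.2.2 = 0)).card ≤ 1) ∧ (∀ a' ∈ A, ∀ c' ∈ C, ((A ×ˢ B ×ˢ C).filter (fun t : ZMod p × ZMod p × ZMod p => a' + t.2.1 + t.2.2 = 0 ∧ t.1 + t.2.1 + c' = 0)).card ≤ 1) ∧ (∀ b' ∈ B, ∀ c' ∈ C, ((A ×ˢ B ×ˢ C).filter (fun t : ZMod p × ZMod p × ZMod p => t.1 + b' + t.2.2 = 0 ∧ t.1 + t.2.1 + c' = 0)).card ≤ 1)) → ((((A ×ˢ B ×ˢ C).filter (fun t : ZMod p × ZMod p × ZMod p => t.1 + t.2.1 + t.2.2 = 0)).card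 : ℕ) : ℝ) ≤ K * (p : ℝ) ^ (1 + ε)

end Summit.MatrixMultiplication.MatrixMultiplication.Theses.EisensteinValCertificates
end buildfix_record


-- single-conjunct summit: the mandated namespace repeats `MatrixMultiplication`.
set_option linter.dupNamespace false

namespace Summit.MatrixMultiplication.MatrixMultiplication.Theorems

open Summit.MatrixMultiplication.MatrixMultiplication.Theses.EisensteinValCertificates
open Literature.Computability.AlgebraicComplexity Finset

/-- Refutes `EisensteinValCertificates.PrimeValConjecture` [refuted-substantive]: Pratt's
Conjecture 4.1 fails at prime moduli — there are `c, K > 0` with `Val(ℤ/Pℤ) ≥ K P^{1+c}` for EVERY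
prime `P` (tree theorem `AutomaticPackingThesis.prattVal_prime_not_subpolynomial`: the CKSU 2005 §5
two-triple design in `ℤ/140`, mass `144 > 140`, powered losslessly along the cyclic `140`-tower and
reflected into `ℤ/Pℤ`), while the conjecture at `ε := c/2` caps `Val(ℤ/Pℤ)` — realised by an
equilateral-trapezoid-free triple (`exists_prattVal_eq`) — at `K' P^{1+c/2}`.  Witness: the primes
`P → ∞` against the `140`-tower designs.  No cheap repair: restricting to primes is already the
statement; a fixed-exponent weakening `Val(ℤ/p) ≤ K p^{1+c₀}` (`c₀ ≥ log 141/log 140 − 1`) is open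
and no longer feeds Pratt Thm 4.4 (whose conclusion is now unconditionally true, tree theorem
`prattVal_superlinear`), and the `4/3 − δ`, `3/2 − δ` savings are the separate items
`PrimeFourThirdsSaving`, `PrimeValSaving`.  barrier-candidate: Val-transfer barrier — `Val(ℤ/n)` is
superlinear unconditionally, so Val-type certificates cannot obstruct STPP designs in `(ℤ/q)^ℓ`
with `q → ∞`. [cite: Pratt2024, Conj. 4.1] [cite: CohnKleinbergSzegedyUmans2005, §5] -/
theorem EisensteinValCertificatesPrimeValConjecture_refuted : ¬ PrimeValConjecture := by
  intro h
  apply AutomaticPackingThesis.prattVal_prime_not_subpolynomial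
  intro ε hε
  obtain ⟨K, hK⟩ := h ε hε
  refine ⟨K, fun p hp => ?_⟩
  obtain ⟨A, B, C, hfree, hval⟩ := exists_prattVal_eq (G := ZMod p)
  have key := hK p hp.out A B C hfree
  rw [← hval]
  exact key

end Summit.MatrixMultiplication.MatrixMultiplication.Theorems
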